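import Summits.HubbardSuperconductivity.HubbardSuperconductivity.Theorems.WeakCouplingBCSDefsKlCertTPrime

/-!
# The «harmonic dual» leaf: a Kohn–Luttinger cell certificate from finitely many real-space Lindhard coefficients plus an analytic tail

Reader seat hubbard-klscan-idea-3 (lens: dual certificates / obstruction reading of the margin table), round 8 (instrument cut §1–§3, round 9); bears on the certificate half
of `Theses.WeakCouplingBCS.WcbcsKohnLuttingerB1g` (stmt-HubbardSuperconductivity-0158) and on the director's pricing of the KL-MARGIN-SCAN table
(HQ1 (i)–(iii)).  HONEST FRAMING: a Kohn–Luttinger `O(U²)` channel statement is not ODLRO and nothing here proves superconductivity in the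
Hubbard model; NO margin at any cell is asserted; nothing is said about `K₃`, `U₀` or the onset window; the file contains NO numerical record and
it states named hypotheses as `Prop`-valued definitions carried as hypotheses, never as claims (the cell-specific targets of the reader card's §4 are NOT in this file).

THE DUAL READING.  Every certified word of the scan is PRIMAL: the kernel `χ₀(k + k′)` is sampled on `N` Fermi-curve cells and the price of a
cell is the geometric discretisation budget `B_N` (`∝ N^{-0.5…-0.7}`, cost `∝ N²`).  The Fourier-DUAL discretisation truncates instead the
lattice-harmonic (real-space) expansion `χ₀(q) = Σ_{R ∈ ℤ²} χ̂₀(R) cos(R·q)`, i.e. `K(k,k′) = Σ_R χ̂₀(R) [c_R(k)c_R(k′) − s_R(k)s_R(k′)]`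
(`c_R = cos(R·k)`, `s_R = sin(R·k)`): the kernel is an absolutely convergent sum of RANK-TWO pieces weighted by the real-space Lindhard
coefficients (the RKKY / Friedel range function of the band).  Keeping `|R|_∞ ≤ R₀` leaves a finite-rank form whose channel bottoms are finite
interval eigenproblems over explicit Fermi-curve integrals of trigonometric polynomials (the cert lane's integrals) and over `≈ (2R₀+1)²/8`
coefficients `χ̂₀(R)`, each ONE frequency integral of a squared lattice Green's function (`χ̂₀(R) = −π⁻¹ ∫₀^∞ Re G_R(μ+iω)² dω`, a `2`-second
float; two independent float routes agree to `1e-4`).  The TAIL `|R|_∞ > R₀` is bounded in every channel at once by Abel summation from two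
cell constants: a Friedel decay amplitude `|χ̂₀(R)|·|R|² ≤ A` (H1) and the linear `L²`-trace growth of the Fermi curve
`Σ_{|R|_∞ ≤ s} |∫ f e^{iR·k} dσ|² ≤ C (s+1) ‖f‖²_σ` (H2, the lattice form of Hörmander's Theorem 7.1.26, curvature-free): `‖tail‖ ≤ 3CA/(R₀+1)`
(§1, PROVED here as finite-sum arithmetic).  So a cell is decided by `R₀ ≈ 12–24` harmonics when `gap > 6CA/(R₀+1)`; floats at the granted cell
`(δ,t′) = (⅛, −0.3)`: `A ≈ 0.045`, `C ≈ 11`, truncated gap `0.24` stable from `R₀ = 8` on, true tails `0.016–0.021` at `R₀ = 8` (bound `≈ 4×` pessimistic).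
OBSTRUCTION READING: a margin that FAILS at a cell while (H1)–(H2) hold certifies that the finite `R₀`-harmonic problem is within `6CA/(R₀+1)` of
degenerate (`truncatedGap_small_of_failed_margin`) — channel competition is visible at range `R₀`; and the dual certificate has failure modes
independent of the primal one (no `B_N`), so it can adjudicate an UNDECIDED primal cell.  Where it is blunt (by value): near the van Hove level and on
flat-faced Fermi curves the sup-amplitude `A` is attained on few directions and the crude bound overcharges (`≈ 15×` at `(0.35, −0.1)`); the
uniformly curved `M`-pocket cells of the `t′` half are its domain.

* §1 Abel summation with a linear partial-sum budget (`abel_identity`, `abel_tail_le`) and the inverse-square corollary `abel_tail_inv_sq`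
  (`≤ 3CA/(m+1)`, via Mathlib's `sum_Ioc_inv_sq_le_sub`) — the arithmetic of «(H1) × (H2) ⇒ tail bound».
* §2 abstract truncation certificate: infima of nearby functionals are nearby (`sInf_image_ge_of_near`, `sInf_image_le_of_near`), the margin
  transfer `truncation_certificate`, and the obstruction reading `truncatedGap_small_of_failed_margin`.
* §3 the KL objects for the `t`–`t′` band: real-space coefficient `klRealSpaceCoeffTP`, the sup-norm shell `shellBall`, the truncated Lindhard function
  and pairing form, `truncatedChannelInfTP`, the named hypotheses `KlTailBoundTP`, `KlFriedelDecayTP` (H1), `KlTraceGrowthTP` (H2), the analytic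
  tail schema `KlTailFromDecayTP` (statement; its functional-analytic half — Bessel bookkeeping on `L²(σ)` — is NOT proved here), and the soundness
  theorem `klB1gDominatesAtTP_of_truncation` (truncated gaps + tail bounds ⇒ the cell conclusion `KLB1gDominatesAtTP`).

References: L. Hörmander, *The Analysis of Linear Partial Differential Operators I* (Springer 2003), Thm 7.1.26 (the `L²` trace growth
`∫_{|ξ|<R} |(u dS)^|² ≤ C R ∫|u|² dS`, no curvature hypothesis) and Thm 7.7.14 (curvature decay); M. Salmhofer, *Renormalization* (Springer 1999),
§4.5.4 (the ladder/KL kernel as an operator on the DOS-weighted `L²` of the Fermi surface; Fermi surface harmonics) and Thm 4.12; P. B. Allen,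
Phys. Rev. B 13 (1976) 1416 (Fermi-surface harmonics); M. T. Béal-Monod, Phys. Rev. B 36 (1987) 8835 (2D RKKY range function `∝ R⁻²`);
S. Raghu, S. A. Kivelson, D. J. Scalapino, Phys. Rev. B 81 (2010) 224505, §II–III.
-/

noncomputable section

-- the tree's namespace convention repeats the summit name by design (D-0017)
set_option linter.dupNamespace false

open Set MeasureTheory
open Literature.MathematicalPhysics.QuantumLattice
open Summit.HubbardSuperconductivity.HubbardSuperconductivity.Theorems
open Summit.HubbardSuperconductivity.HubbardSuperconductivity.Theorems.CwKLChiralWindow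

namespace Summit.HubbardSuperconductivity.HubbardSuperconductivity.Theorems.KlHarmonicDual

/-! ## §1  Abel summation with a linear partial-sum budget -/

/-- **Abel identity.**  The boundary term plus the weighted difference sum telescopes:
`(n+2)·a(n+1) + Σ_{m<i≤n} (i+1)(a i − a (i+1)) = (m+2)·a(m+1) + Σ_{m+1<i≤n+1} a i`. [folklore] -/
theorem abel_identity (a : ℕ → ℝ) (m : ℕ) :
    ∀ n, m ≤ n → ((n : ℝ) + 2) * a (n + 1) + ∑ i ∈ Finset.Ioc m n, ((i : ℝ) + 1) * (a i - a (i + 1)) =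
      ((m : ℝ) + 2) * a (m + 1) + ∑ i ∈ Finset.Ioc (m + 1) (n + 1), a i := by
  intro n hn
  induction n, hn using Nat.le_induction with
  | base => simp
  | succ n hn ih =>
    rw [Finset.sum_Ioc_succ_top hn, Finset.sum_Ioc_succ_top (by omega : m + 1 ≤ n + 1)]
    push_cast
    linarith [ih]

/-- **Abel tail bound.**  If `a` is non-increasing and non-negative beyond `m`, `b ≥ 0`, and the partial sums of `b` grow at most linearly,
`Σ_{i<k} b i ≤ C k`, then `Σ_{m<i≤n+1} a i · b i ≤ C · ((m+2)·a(m+1) + Σ_{m+1<i≤n+1} a i)` — summation by parts (Mathlib's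
`Finset.sum_Ioc_by_parts`) followed by `abel_identity`. [folklore] -/
theorem abel_tail_le {a b : ℕ → ℝ} {C : ℝ} {m n : ℕ} (hmn : m ≤ n)
    (hmono : ∀ i, m < i → a (i + 1) ≤ a i) (hpos : ∀ i, m < i → 0 ≤ a i) (hb : ∀ i, 0 ≤ b i)
    (hB : ∀ k : ℕ, ∑ i ∈ Finset.range k, b i ≤ C * k) :
    ∑ i ∈ Finset.Ioc m (n + 1), a i * b i ≤
      C * (((m : ℝ) + 2) * a (m + 1) + ∑ i ∈ Finset.Ioc (m + 1) (n + 1), a i) := by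
  have key : ∑ i ∈ Finset.Ioc m (n + 1), a i * b i =
      a (n + 1) * ∑ j ∈ Finset.range (n + 1 + 1), b j - a (m + 1) * ∑ j ∈ Finset.range (m + 1), b j -
        ∑ i ∈ Finset.Ioc m n, (a (i + 1) - a i) * ∑ j ∈ Finset.range (i + 1), b j := by
    have h := Finset.sum_Ioc_by_parts a b (show m < n + 1 by omega)
    simpa only [smul_eq_mul, add_tsub_cancel_right] using h
  have h1 : a (n + 1) * ∑ j ∈ Finset.range (n + 1 + 1), b j ≤ a (n + 1) * (C * ((n : ℝ) + 2)) := by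
    refine mul_le_mul_of_nonneg_left ?_ (hpos _ (by omega))
    have := hB (n + 1 + 1)
    push_cast at this
    linarith
  have h2 : 0 ≤ a (m + 1) * ∑ j ∈ Finset.range (m + 1), b j :=
    mul_nonneg (hpos _ (by omega)) (Finset.sum_nonneg fun j _ => hb j)
  have h3 : ∑ i ∈ Finset.Ioc m n, (a i - a (i + 1)) * ∑ j ∈ Finset.range (i + 1), b j ≤
      ∑ i ∈ Finset.Ioc m n, (a i - a (i + 1)) * (C * ((i : ℝ) + 1)) := by
    refine Finset.sum_le_sum fun i hi => ?_
    have hi' : m < i := (Finset.mem_Ioc.mp hi).1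
    refine mul_le_mul_of_nonneg_left ?_ (sub_nonneg.mpr (hmono i hi'))
    have := hB (i + 1)
    push_cast at this
    linarith
  have h4 : ∑ i ∈ Finset.Ioc m n, (a (i + 1) - a i) * ∑ j ∈ Finset.range (i + 1), b j =
      -∑ i ∈ Finset.Ioc m n, (a i - a (i + 1)) * ∑ j ∈ Finset.range (i + 1), b j := by
    rw [← Finset.sum_neg_distrib]
    exact Finset.sum_congr rfl fun i _ => by ring
  have h5 : ∑ i ∈ Finset.Ioc m n, (a i - a (i + 1)) * (C * ((i : ℝ) + 1)) =
      C * ∑ i ∈ Finset.Ioc m n, ((i : ℝ) + 1) * (a i - a (i + 1)) := by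
    rw [Finset.mul_sum]
    exact Finset.sum_congr rfl fun i _ => by ring
  have hid : C * (((n : ℝ) + 2) * a (n + 1) + ∑ i ∈ Finset.Ioc m n, ((i : ℝ) + 1) * (a i - a (i + 1))) =
      C * (((m : ℝ) + 2) * a (m + 1) + ∑ i ∈ Finset.Ioc (m + 1) (n + 1), a i) := by
    rw [abel_identity a m n hmn]
  rw [key, h4]
  linarith [h1, h2, h3, h5, hid]

/-- **Inverse-square profile.**  With `a i = A / i²` (`A ≥ 0`, `C ≥ 0`) the Abel tail bound is uniform in the upper limit:
`Σ_{m<i≤n+1} (A/i²) b i ≤ 3CA/(m+1)` (uses Mathlib's `sum_Ioc_inv_sq_le_sub : Σ_{k<i≤n} 1/i² ≤ 1/k − 1/n`).  This is the arithmetic of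
«Friedel decay (H1) × trace growth (H2) ⇒ tail bound `3CA/(R₀+1)`». [folklore] -/
theorem abel_tail_inv_sq {A C : ℝ} {b : ℕ → ℝ} {m n : ℕ} (hA : 0 ≤ A) (hC : 0 ≤ C) (hmn : m ≤ n)
    (hb : ∀ i, 0 ≤ b i) (hB : ∀ k : ℕ, ∑ i ∈ Finset.range k, b i ≤ C * k) :
    ∑ i ∈ Finset.Ioc m (n + 1), A / (i : ℝ) ^ 2 * b i ≤ 3 * C * A / ((m : ℝ) + 1) := by
  have hm1 : (0 : ℝ) < (m : ℝ) + 1 := by positivity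
  have hmono : ∀ i, m < i → A / ((i + 1 : ℕ) : ℝ) ^ 2 ≤ A / (i : ℝ) ^ 2 := by
    intro i hi
    have hi0 : (0 : ℝ) < i := by exact_mod_cast (show 0 < i by omega)
    exact div_le_div_of_nonneg_left hA (pow_pos hi0 2) (by push_cast; nlinarith)
  have hpos : ∀ i, m < i → 0 ≤ A / (i : ℝ) ^ 2 := fun i _ => div_nonneg hA (sq_nonneg _)
  have h := abel_tail_le (a := fun i => A / (i : ℝ) ^ 2) hmn hmono hpos hb hB
  have hs : ∑ i ∈ Finset.Ioc (m + 1) (n + 1), A / (i : ℝ) ^ 2 =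
      A * ∑ i ∈ Finset.Ioc (m + 1) (n + 1), ((i : ℝ) ^ 2)⁻¹ := by
    rw [Finset.mul_sum]
    exact Finset.sum_congr rfl fun i _ => by rw [div_eq_mul_inv]
  have hP : ∑ i ∈ Finset.Ioc (m + 1) (n + 1), ((i : ℝ) ^ 2)⁻¹ ≤ ((m + 1 : ℕ) : ℝ)⁻¹ - ((n + 1 : ℕ) : ℝ)⁻¹ :=
    sum_Ioc_inv_sq_le_sub (α := ℝ) (by omega) (by omega)
  have hn1 : (0 : ℝ) ≤ ((n + 1 : ℕ) : ℝ)⁻¹ := by positivity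
  have hm1' : ((m + 1 : ℕ) : ℝ)⁻¹ = 1 / ((m : ℝ) + 1) := by push_cast; rw [one_div]
  have hsum : ∑ i ∈ Finset.Ioc (m + 1) (n + 1), A / (i : ℝ) ^ 2 ≤ A * (1 / ((m : ℝ) + 1)) := by
    rw [hs]; exact mul_le_mul_of_nonneg_left (by linarith [hP, hn1, hm1']) hA
  have hcast : (((m + 1 : ℕ) : ℝ)) = (m : ℝ) + 1 := by push_cast; ring
  have hm0 : ((m : ℝ) + 1) ≠ 0 := ne_of_gt hm1
  have hquot : ((m : ℝ) + 2) / ((m : ℝ) + 1) ≤ 2 := by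
    rw [div_le_iff₀ hm1]
    linarith [(Nat.cast_nonneg m : (0 : ℝ) ≤ m)]
  have hhead : ((m : ℝ) + 2) * (A / ((m : ℝ) + 1) ^ 2) ≤ 2 * A * (1 / ((m : ℝ) + 1)) := by
    have e : ((m : ℝ) + 2) * (A / ((m : ℝ) + 1) ^ 2) = (A * (1 / ((m : ℝ) + 1))) * (((m : ℝ) + 2) / ((m : ℝ) + 1)) := by
      field_simp
    rw [e]
    have : (A * (1 / ((m : ℝ) + 1))) * (((m : ℝ) + 2) / ((m : ℝ) + 1)) ≤ (A * (1 / ((m : ℝ) + 1))) * 2 :=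
      mul_le_mul_of_nonneg_left hquot (by positivity)
    linarith
  have hX : ((m : ℝ) + 2) * (A / ((m : ℝ) + 1) ^ 2) + ∑ i ∈ Finset.Ioc (m + 1) (n + 1), A / (i : ℝ) ^ 2 ≤
      3 * A * (1 / ((m : ℝ) + 1)) := by linarith [hhead, hsum]
  have hfin : C * (((m : ℝ) + 2) * (A / ((m : ℝ) + 1) ^ 2) + ∑ i ∈ Finset.Ioc (m + 1) (n + 1), A / (i : ℝ) ^ 2) ≤
      C * (3 * A * (1 / ((m : ℝ) + 1))) := mul_le_mul_of_nonneg_left hX hC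
  have hrw : (fun i : ℕ => A / (i : ℝ) ^ 2) (m + 1) = A / ((m : ℝ) + 1) ^ 2 := by simp [hcast]
  calc ∑ i ∈ Finset.Ioc m (n + 1), A / (i : ℝ) ^ 2 * b i
      ≤ C * (((m : ℝ) + 2) * (A / ((m : ℝ) + 1) ^ 2) + ∑ i ∈ Finset.Ioc (m + 1) (n + 1), A / (i : ℝ) ^ 2) := by
        simpa [hcast] using h
    _ ≤ C * (3 * A * (1 / ((m : ℝ) + 1))) := hfin
    _ = 3 * C * A / ((m : ℝ) + 1) := by ring

/-! ## §2  The abstract truncation certificate and its obstruction reading -/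

/-- A functional lying within `τ` ABOVE another on a state set has infimum at least the other's infimum minus `τ`. [folklore] -/
theorem sInf_image_ge_of_near {ι : Type*} {S : Set ι} {q t : ι → ℝ} {τ : ℝ} (hS : S.Nonempty) (ht : BddBelow (t '' S))
    (h : ∀ ψ ∈ S, t ψ - τ ≤ q ψ) : sInf (t '' S) - τ ≤ sInf (q '' S) := by
  refine le_csInf (hS.image q) ?_
  rintro _ ⟨ψ, hψ, rfl⟩
  have : sInf (t '' S) ≤ t ψ := csInf_le ht ⟨ψ, hψ, rfl⟩
  linarith [h ψ hψ]

/-- A functional lying within `τ` BELOW another on a state set has infimum at most the other's infimum plus `τ`. [folklore] -/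
theorem sInf_image_le_of_near {ι : Type*} {S : Set ι} {q t : ι → ℝ} {τ : ℝ} (hS : S.Nonempty) (hq : BddBelow (q '' S))
    (h : ∀ ψ ∈ S, q ψ ≤ t ψ + τ) : sInf (q '' S) ≤ sInf (t '' S) + τ := by
  have : sInf (q '' S) - τ ≤ sInf (t '' S) := by
    refine le_csInf (hS.image t) ?_
    rintro _ ⟨ψ, hψ, rfl⟩
    have : sInf (q '' S) ≤ q ψ := csInf_le hq ⟨ψ, hψ, rfl⟩
    linarith [h ψ hψ]
  linarith

/-- **Truncation certificate.**  If the full forms `q` are within the tail budgets `τ_B`, `τ_χ` of the truncated forms `t` on the two state sets,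
a truncated gap `inf t_B + γ + τ_B + τ_χ ≤ inf t_χ` transfers to the full gap `inf q_B + γ ≤ inf q_χ`. [folklore] -/
theorem truncation_certificate {ι : Type*} {SB Sχ : Set ι} {qB tB qχ tχ : ι → ℝ} {τB τχ γ : ℝ}
    (hSB : SB.Nonempty) (hSχ : Sχ.Nonempty) (hqB : BddBelow (qB '' SB)) (htχ : BddBelow (tχ '' Sχ))
    (hB : ∀ ψ ∈ SB, qB ψ ≤ tB ψ + τB) (hχ : ∀ ψ ∈ Sχ, tχ ψ - τχ ≤ qχ ψ)
    (hgap : sInf (tB '' SB) + γ + τB + τχ ≤ sInf (tχ '' Sχ)) :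
    sInf (qB '' SB) + γ ≤ sInf (qχ '' Sχ) := by
  have h1 := sInf_image_le_of_near hSB hqB hB
  have h2 := sInf_image_ge_of_near hSχ htχ hχ
  linarith

/-- **Obstruction reading** («what a failed margin certifies»).  If the full margin `γ` FAILS while the tail budgets hold, the truncated
(finite-rank, range-`R₀`) problem has gap `< γ + τ_B + τ_χ`: channel competition is visible at range `R₀`. [folklore] -/
theorem truncatedGap_small_of_failed_margin {ι : Type*} {SB Sχ : Set ι} {qB tB qχ tχ : ι → ℝ} {τB τχ γ : ℝ}
    (hSB : SB.Nonempty) (hSχ : Sχ.Nonempty) (hqB : BddBelow (qB '' SB)) (htχ : BddBelow (tχ '' Sχ))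
    (hB : ∀ ψ ∈ SB, qB ψ ≤ tB ψ + τB) (hχ : ∀ ψ ∈ Sχ, tχ ψ - τχ ≤ qχ ψ)
    (hfail : sInf (qχ '' Sχ) < sInf (qB '' SB) + γ) :
    sInf (tχ '' Sχ) < sInf (tB '' SB) + γ + τB + τχ := by
  by_contra hnot
  exact absurd (truncation_certificate hSB hSχ hqB htχ hB hχ (not_lt.mp hnot)) (not_le.mpr hfail)

/-! ## §3  The KL objects: real-space Lindhard coefficients, the truncated form, the named hypotheses, soundness -/

/-- The lattice phase `R·k = R₁ k₀ + R₂ k₁` of the harmonic `e^{iR·k}`, `R ∈ ℤ²`. [folklore] -/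
def latticePhase (R : ℤ × ℤ) (k : Momentum) : ℝ := (R.1 : ℝ) * k 0 + (R.2 : ℝ) * k 1

/-- **Real-space (lattice-harmonic) Lindhard coefficient** of the `t`–`t′` band at `μ`: `χ̂₀(R) = (2π)⁻² ∫_{BZ} χ₀(q; μ) cos(R·q) dq` — the
Fourier coefficient of the (even, `2π`-periodic) static Lindhard function; physically the RKKY / Friedel range function of the band.
[cite: RaghuKivelsonScalapino2010, §II (5)] -/
def klRealSpaceCoeffTP (tp μ : ℝ) (R : ℤ × ℤ) : ℝ :=
  (∫ q in brillouinZone, lindhardFunction (squareDispersion 1 tp) μ q * Real.cos (latticePhase R q)) / (2 * Real.pi) ^ 2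

/-- The sup-norm ball of lattice vectors `{R ∈ ℤ² : |R|_∞ ≤ s}`. [folklore] -/
def shellBall (s : ℕ) : Finset (ℤ × ℤ) := Finset.Icc (-(s : ℤ)) s ×ˢ Finset.Icc (-(s : ℤ)) s

/-- The **truncated Lindhard function** of range `R₀`: `χ₀^{(R₀)}(q) = Σ_{|R|_∞ ≤ R₀} χ̂₀(R) cos(R·q)` (a trigonometric polynomial; as a kernel
`χ₀^{(R₀)}(k+k′) = Σ_R χ̂₀(R)[c_R(k)c_R(k′) − s_R(k)s_R(k′)]` it has rank `≤ 2(2R₀+1)²`). [folklore] -/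
def truncatedLindhardTP (R₀ : ℕ) (tp μ : ℝ) (q : Momentum) : ℝ :=
  ∑ R ∈ shellBall R₀, klRealSpaceCoeffTP tp μ R * Real.cos (latticePhase R q)

/-- The **truncated pairing form** at `U = 1`: the quadratic form of the kernel `1 + χ₀^{(R₀)}(k + k′)` on `L²` of the Fermi-curve measure of
`ε_{t′}` at `μ` (compare `pairingForm ε μ 1`, kernel `1 + χ₀(k + k′)`). [folklore] -/
def truncatedPairingFormTP (R₀ : ℕ) (tp μ : ℝ) (ψ : Momentum → ℝ) : ℝ :=
  ∫ k, ψ k * ∫ k', (1 + truncatedLindhardTP R₀ tp μ (k + k')) * ψ k'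
    ∂fermiCurveMeasure (squareDispersion 1 tp) μ ∂fermiCurveMeasure (squareDispersion 1 tp) μ

/-- The channel bottom of the truncated form: `inf` over normalised channel states (same state set as `channelInf`). [folklore] -/
def truncatedChannelInfTP (R₀ : ℕ) (tp μ : ℝ) (χ : D4Irrep) : ℝ :=
  sInf (truncatedPairingFormTP R₀ tp μ '' {ψ | IsChannelState (squareDispersion 1 tp) μ χ ψ})

/-- **Tail budget** in the channel `χ` at range `R₀`: on normalised channel states the full and truncated forms differ by at most `τ`. [folklore] -/
def KlTailBoundTP (R₀ : ℕ) (tp μ τ : ℝ) (χ : D4Irrep) : Prop :=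
  ∀ ψ, IsChannelState (squareDispersion 1 tp) μ χ ψ →
    |pairingForm (squareDispersion 1 tp) μ 1 ψ - truncatedPairingFormTP R₀ tp μ ψ| ≤ τ

/-- **(H1) Friedel decay** beyond range `R₁` with amplitude `A`: `|χ̂₀(R)|·|R|₂² ≤ A` for `|R|_∞ > R₁` (the `R⁻²` law of the 2D range function,
asserted with an explicit constant at one cell; the research-grade input). [cite: RaghuKivelsonScalapino2010, §II (5)] -/
def KlFriedelDecayTP (tp μ A : ℝ) (R₁ : ℕ) : Prop :=
  ∀ R : ℤ × ℤ, (R₁ : ℤ) < max |R.1| |R.2| → |klRealSpaceCoeffTP tp μ R| * ((R.1 : ℝ) ^ 2 + (R.2 : ℝ) ^ 2) ≤ A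

/-- **(H2) Trace growth** of the Fermi curve with constant `C`: the harmonic coefficients of any `L²(σ)` density have ball sums growing at most
linearly, `Σ_{|R|_∞ ≤ s} (|∫ f c_R dσ|² + |∫ f s_R dσ|²) ≤ C (s+1) ∫ f² dσ` — the lattice form of the `L²` trace lemma for measures carried by
`C¹` curves (no curvature needed). [folklore] -/
def KlTraceGrowthTP (tp μ C : ℝ) : Prop :=
  ∀ s : ℕ, ∀ f : Momentum → ℝ, MemLp f 2 (fermiCurveMeasure (squareDispersion 1 tp) μ) →
    ∑ R ∈ shellBall s,
        ((∫ k, f k * Real.cos (latticePhase R k) ∂fermiCurveMeasure (squareDispersion 1 tp) μ) ^ 2 +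
          (∫ k, f k * Real.sin (latticePhase R k) ∂fermiCurveMeasure (squareDispersion 1 tp) μ) ^ 2) ≤
      C * ((s : ℝ) + 1) * ∫ k, f k ^ 2 ∂fermiCurveMeasure (squareDispersion 1 tp) μ

/-- **The analytic tail schema** — an UNPROVED schema, carried as a hypothesis wherever it is used (statement only, no tag of establishment):
decay (H1) beyond `R₁ ≤ R₀` and trace growth (H2) give the tail budget `3CA/(R₀+1)` in every channel.  Its ARITHMETIC is `abel_tail_inv_sq` (§1);
the functional-analytic half (expanding the tail form in harmonics shell by shell on `L²(σ)`, Bessel bookkeeping, `|R|₂ ≥ |R|_∞`) is not done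
in this file. -/
def KlTailFromDecayTP (tp μ : ℝ) : Prop :=
  ∀ A C : ℝ, ∀ R₁ R₀ : ℕ, 0 ≤ A → 0 ≤ C → R₁ ≤ R₀ → KlFriedelDecayTP tp μ A R₁ → KlTraceGrowthTP tp μ C →
    ∀ χ : D4Irrep, KlTailBoundTP R₀ tp μ (3 * C * A / ((R₀ : ℝ) + 1)) χ

/-- **Soundness of the harmonic-dual cell certificate.**  Truncated gaps `γ + τ_B + τ_χ` at range `R₀` plus tail budgets in every channel give
the cell conclusion `KLB1gDominatesAtTP tp μ μ γ` (degenerate `μ`-window).  The non-emptiness / boundedness side conditions are hypotheses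
(in the tree they are established for `t′ = 0` on `μ ∈ (−4, 0)`). [cite: RaghuKivelsonScalapino2010, §II (7), (13)] -/
theorem klB1gDominatesAtTP_of_truncation {tp μ γ : ℝ} {R₀ : ℕ} {τ : D4Irrep → ℝ}
    (hS : ∀ χ, {ψ | IsChannelState (squareDispersion 1 tp) μ χ ψ}.Nonempty)
    (hq : ∀ χ, BddBelow (pairingForm (squareDispersion 1 tp) μ 1 '' {ψ | IsChannelState (squareDispersion 1 tp) μ χ ψ}))
    (ht : ∀ χ, BddBelow (truncatedPairingFormTP R₀ tp μ '' {ψ | IsChannelState (squareDispersion 1 tp) μ χ ψ}))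
    (htail : ∀ χ, KlTailBoundTP R₀ tp μ (τ χ) χ)
    (hgap : ∀ χ, χ ≠ D4Irrep.B1g →
      truncatedChannelInfTP R₀ tp μ D4Irrep.B1g + γ + τ D4Irrep.B1g + τ χ ≤ truncatedChannelInfTP R₀ tp μ χ) :
    KLB1gDominatesAtTP tp μ μ γ := by
  intro μ' hμ' χ hχ
  obtain rfl : μ' = μ := le_antisymm hμ'.2 hμ'.1
  unfold channelInf
  refine truncation_certificate (hS D4Irrep.B1g) (hS χ) (hq D4Irrep.B1g) (ht χ) ?_ ?_ (hgap χ hχ)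
  · intro ψ hψ
    have := (abs_le.mp (htail D4Irrep.B1g ψ hψ)).2
    linarith
  · intro ψ hψ
    have := (abs_le.mp (htail χ ψ hψ)).1
    linarith

end Summit.HubbardSuperconductivity.HubbardSuperconductivity.Theorems.KlHarmonicDual

end
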